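import Mathlib
import HarnessLib

/-!
# The g.c.d. of `aⁿ − 1` and `bⁿ − 1` (Bugeaud–Corvaja–Zannier 2003)

Topic `Literature/NumberTheory/DiophantineGeometry` (next to `FunctionFieldGCD.lean`, the
function-field analogue of Corvaja–Zannier 2008, and `FunctionFieldUnitEquation.lean`).

Y. Bugeaud, P. Corvaja, U. Zannier, *An upper bound for the G.C.D. of `aⁿ − 1` and `bⁿ − 1`*,
Math. Z. 243 (2003), no. 1, 79–84 [BugeaudCorvajaZannier2003] (a consequence of Schmidt's Subspace
Theorem). The journal text is paywalled for this hub (acquisition request filed); the statement is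
vendored from two concordant printed sources that were READ:

* the zbMATH review Zbl 1021.11001 (A. van der Poorten): "the authors show … that if `a` and `b`
  are multiplicatively independent then, for every `ε > 0` and `n` sufficiently large,
  `gcd(aⁿ−1, bⁿ−1)` is no greater than `exp(εn)`";
* the authors' own restatement, P. Corvaja, U. Zannier, *A lower bound for the height of a
  rational function at `S`-unit points*, Monatsh. Math. 144 (2005) = arXiv:math/0311030, p. 1:
  "Let `a, b` be given multiplicatively independent positive integers and let `ε > 0`. In the
  paper [1] a nearly best-possible upper bound `exp(εn)` for g.c.d.`(aⁿ−1, bⁿ−1)` was proved, as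
  the integer `n` tends to infinity." (There it is generalised to `gcd(u−1, v−1) < max(|u|,|v|)^ε`
  for multiplicatively independent `S`-units, Cor. 1 / (1.3), not vendored here.)

Rendering: `a, b : ℕ` with `2 ≤ a`, `2 ≤ b` (positive and multiplicatively independent forces
`a, b ≥ 2`); multiplicative independence of two integers `≥ 2` = no relation `a^r = b^s` with
`(r, s) ∈ ℕ² ∖ {(0,0)}` (for integers `≥ 2` this is the same as independence with exponents in
`ℤ`); the conclusion in the weak form "`≤ exp(εn)`" of the review (the paper's "`<`" implies it),
eventually in `n`. `aⁿ − 1` is natural-number subtraction, exact since `aⁿ ≥ 1`.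

Why here: it is the ARITHMETIC counterpart of the function-field gcd laws
`CorvajaZannier2008_cor23` (FunctionFieldGCD.lean) and of Ailon–Rudnick's bounded
`deg gcd(fⁿ−1, gⁿ−1)` — the "BCZ ↔ Ailon–Rudnick" comparison invoked by the refuters of the ABC
route `Summits/ABC/ABC/Theses/GvfSupportTransfer.lean` (items `GenusNegligibleDensity`,
`LinearLawTransfer`): on both sides the gcd profile is `o(height)`, so no transfer law is
violated at the linear scale. Not in Mathlib or the tree (searched `Bugeaud`, `Ailon`,
`gcd_pow_sub_one`, `pow_sub_one_gcd`: the only hit is the one-base identity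
`Literature.Computability.Cryptography.ShorRoundFP.gcd_pow_sub_one_eq`; `Bugeaud2004_thm_8_11`
is unrelated approximation by algebraic numbers).
-/

namespace Literature.NumberTheory.DiophantineGeometry

/-- **Bugeaud–Corvaja–Zannier 2003** (Math. Z. 243 (2003) 79–84, Theorem 1; wording per
Zbl 1021.11001 and the authors' restatement in arXiv:math/0311030 p. 1): if the integers
`a, b ≥ 2` are multiplicatively independent (no `a^r = b^s` with `(r,s) ≠ (0,0)`), then for every
`ε > 0` one has `gcd(aⁿ − 1, bⁿ − 1) ≤ exp(ε n)` for all sufficiently large `n` ("nearly best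
possible" per the authors). A consequence of the Subspace Theorem; a named fact, users take
`(h : BugeaudCorvajaZannier2003_thm1)`.
[cite: BugeaudCorvajaZannier2003, Thm 1] -/
def BugeaudCorvajaZannier2003_thm1 : Prop :=
  ∀ a b : ℕ, 2 ≤ a → 2 ≤ b → (∀ r s : ℕ, a ^ r = b ^ s → r = 0 ∧ s = 0) →
    ∀ ε : ℝ, 0 < ε → ∃ n₀ : ℕ, ∀ n : ℕ, n₀ ≤ n →
      (Nat.gcd (a ^ n - 1) (b ^ n - 1) : ℝ) ≤ Real.exp (ε * n)

end Literature.NumberTheory.DiophantineGeometry
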